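/-
Copyright (c) 2026. All rights reserved.
Released under Apache 2.0 license as described in the file LICENSE.
Authors: abc-iut cell, seat abc-iut-L6-t6 (gen 8): the integral structure `𝒪_{(−)} = Π_i 𝒪_{k_i}` is a
hull-set (λ = 1), hence its own holomorphic hull — the clause of [IUTchIII] Remark 3.9.7 (i)
«`𝓘((−))` … is equal to its own holomorphic hull» at unramified places, where `𝓘((−)) = 𝒪_{(−)}`.
-/
import Literature.IUT.LogThetaLattice.HolomorphicHullClosure
import HarnessLib

/-!
# [IUTchIII] Remark 3.9.7 (i) / 3.9.5 (i): `𝒪_{(−)}` is a hull-set and equals its own holomorphic hull —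
# proof-only (0 definitions)

S. Mochizuki, *Inter-universal Teichmüller Theory III*, kurims manuscript (May 2020), Remark 3.9.7 (i)
p. 146 l. 11–15 «the subset `𝒪_{(−)} = 𝓘((−)) ⊆ 𝓘^ℚ((−))` … has zero log-volume … the subset `𝓘((−)) ⊆ 𝓘^ℚ((−))`
is a mono-analytic invariant, which, moreover, [cf. Remark 3.9.5, (i)] is equal to its own holomorphic
hull», and Remark 3.9.5 (i) p. 127 (hull-sets `λ·𝒪_{(−)}`) [claim: Mochizuki2012, status: disputed].
abc-iut cell, layer L6, node **IUTchIII:Rmk3.9.7(i)** (per-node clause coverage, abc-iut-L6-t6 g8), over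
abc-iut-L6-t4's `HolomorphicHull.lean` (`IsHullSet`, `holomorphicHull`) and the closure companion
`HolomorphicHullClosure.lean` (`holomorphicHull_of_isHullSet`, p404776). Elementary; nothing here bears
on [IUTchIII] Cor. 3.12; typed ≠ proved elsewhere.
-/

namespace Literature.IUT.LogThetaLattice

universe u v

variable {ι : Type u} {k : ι → Type v} [∀ i, Field (k i)] (O : ∀ i, Subring (k i))

/-- **IUTchIII:Rmk3.9.7(i)** / Rmk 3.9.5 (i) (kurims p.146 l.14–15, p.127): the integral structure
`𝒪_{(−)} = Π_i 𝒪_{k_i}` is a hull-set — the one with `λ = 1`. PROVED. [claim: Mochizuki2012, status: disputed] -/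
theorem isHullSet_pi_integers : IsHullSet O (Set.univ.pi fun i => (O i : Set (k i))) := by
  refine ⟨fun _ => 1, fun _ => one_ne_zero, ?_⟩
  congr 1
  funext i
  ext x
  simp

/-- **IUTchIII:Rmk3.9.7(i)** (kurims p.146 l.14–15) «the subset `𝓘((−)) ⊆ 𝓘^ℚ((−))` … [cf. Remark 3.9.5, (i)]
is equal to its own holomorphic hull» — for `𝓘((−)) = 𝒪_{(−)}` (the unramified case of the remark,
abc-iut-L6-d2's `logShell_ofUnitLog_eq_closedBall_of_unramified`): PROVED whenever `𝒪_{(−)}` is relatively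
compact (local fields: `𝒪_{k_i}` compact), by abc-iut's `holomorphicHull_of_isHullSet`.
[claim: Mochizuki2012, status: disputed] -/
theorem holomorphicHull_pi_integers [∀ i, TopologicalSpace (k i)]
    (hcpt : IsCompact (closure (Set.univ.pi fun i => (O i : Set (k i))))) :
    holomorphicHull O (Set.univ.pi fun i => (O i : Set (k i))) = Set.univ.pi fun i => (O i : Set (k i)) :=
  holomorphicHull_of_isHullSet O (isHullSet_pi_integers O) hcpt

end Literature.IUT.LogThetaLattice
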